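import Literature.Geometry.Symplectic.PlanarHomologySphereFillingsProofs
import Literature.Geometry.Symplectic.SteinPALF
import Mathlib.Analysis.Normed.Module.Connected
import Mathlib.Topology.Homeomorph.Lemmas
import HarnessLib

/-!
# Oba 2016, Thm. 1.1 (`Oba2016_steinFilling_fourHoledSphere`) read through Wendl's PALF and Kas'
# handle count: the fact modulo two printed theorems over `PALF`, and outright for at most two
# binding components

Topic `Literature/Geometry/Symplectic`; third proofs-only companion of
`PlanarHomologySphereFillings.lean` (after `…Proofs.lean` and `…Dictionary.lean`).  Everything here
is PROVED; no definition and no named fact is introduced (D-0026).  The two published inputs of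
Oba's proof are taken as HYPOTHESES, spelled out over the tree's fibration vocabulary
`Literature.Geometry.Symplectic.PALF` (`SteinPALF.lean`, which defers *"the existence theorems
(Akbulut–Ozbagci 2001, Thm. 1; Loi–Piergallini 2001; Wendl 2010, Thm. 1) — named facts filed by
their consumers over this vocabulary"*):

* `hW` — **Wendl 2010, Thm. 1** for compact Stein domains (with "allowable if minimal" and the proof
  of Cor. 1: exact fillings are minimal, no blow-up; Oba 2016, Thm. 1.3): a compact connected Stein
  domain whose boundary complex tangencies are supported by a planar open book `K` carries a
  `PALF S.complexOrientation b` whose boundary open book has planar pages and binding homeomorphic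
  to that of `K`;
* `hK` — **Kas 1980 / Gompf–Stipsicz §8.2, as printed in Oba 2016, §2.2** (p. 5: *"Suppose
  `f : X → D²` is a positive Lefschetz fibration with fiber a compact, oriented, connected genus `g`
  surface `Σ` with `r` boundary components.  Then `X` admits a handle decomposition
  `X = (D² × Σ) ∪ (∪ᵢ h⁽²⁾ᵢ) = (h⁽⁰⁾ ∪ (∪_{j=1}^{2g+r-1} h⁽¹⁾ⱼ)) ∪ (∪_{i=1}^{m} h⁽²⁾ᵢ)`"*, and proof
  of Prop. 3.6: *"the number of `1`-handles is the first Betti number of `Σ_{0,n+1}` i.e., `n`, and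
  that of `2`-handles is the number of the vanishing cycles"*), for planar fibres: a compact
  connected `W` carrying a `PALF o b` with planar boundary pages and `n + 1` binding components has
  a handle decomposition with one `0`-handle, `n` `1`-handles, one `2`-handle per critical point and
  nothing else (`HasHandleDecomposition 3 W (1, n, #crit, 0, 0, …)`).

Neither is within the tree's proved depth (Wendl: compactness of `J`-holomorphic foliations; Kas:
Ehresmann for the bordered fibration, `Σ_{0,n+1} × D² = h⁰ ∪ n h¹`, `2`-handles at the nodes), and a
proving seat may not file them as named facts (D-0026, `lint.fact-fanout`); they are quoted here
verbatim as the bodies such facts would have.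

## Results

* §1 `OpenBook.natCard_connectedComponents_binding_le_k` — the binding of an open book with `k`
  tubes has at most `k` (and at least one) connected components; `natCard_connectedComponents_congr`
  — homeomorphic spaces have equally many.
* §2 `Oba2016_handleCount_of_wendl_of_kas` — under `hW`, `hK`: a compact contractible Stein
  domain whose boundary complex tangencies are supported by a planar open book with `k` tubes has a
  handle decomposition `(1, n, n, 0, 0, …)` with `n + 1 ≤ k` (Wendl's PALF, Kas' count, and
  `χ(W) = 1`: Oba's Props. 3.5–3.6, `Oba2016_prop35_of_contractible`).
* §3 `Oba2016_disjunction_of_oneHandle_le_one` — pointwise form of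
  `Oba2016_steinFilling_fourHoledSphere_of_oneHandle_le_one`: a compact contractible `4`-manifold with
  a handle decomposition with at most one `1`-handle and no handle of index `≥ 3` is `D⁴` or has the
  handle count `(1, 1, 1, 0, …)`.
* §4 **`Oba2016_steinFilling_twoTubes_of_wendl_of_kas`** — the conclusion of the fact for planar
  supporting open books with AT MOST TWO binding tubes (pages a disc or an annulus), from `hW` and
  `hK` alone: then `n ≤ 1` and §3 applies with no cancellation.
* §5 **`Oba2016_steinFilling_fourHoledSphere_of_wendl_of_kas_of_cancel`** — the fact itself from
  `hW`, `hK` and the residual claim `hC` for fibres `Σ_{0,3}`, `Σ_{0,4}`: *a compact contractible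
  Stein domain carrying a planar `PALF` with `n + 1 ∈ {3, 4}` binding components and the Kas count
  `(1, n, n, 0, …)` has a handle decomposition with at most one `1`-handle and none of index `≥ 3`*
  — Oba's §3.2: by `H₁ = 0` a boundary curve occurs among the vanishing cycles, and two
  `1`/`2`-handle pairs of the Kirby diagram (Fig. 2) cancel; in the tree this wants Kas' theorem
  WITH the incidence of vanishing cycles and cocore arcs, feeding Milnor's First Cancellation
  Theorem (`Cobordism.Milnor1965_firstCancellation_slab_holds`).

Compared with `Oba2016_steinFilling_fourHoledSphere_of_supported_of_endgame` (`…Proofs.lean`, via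
the monodromy-chart fact `supportedPlanarMonodromy`) and `…_of_dictionary` (`…Dictionary.lean`, via
the planar word calculus, VACUOUS as filed), this route needs no monodromy chart and no word
calculus: Wendl's theorem is consumed directly on the supporting open book of the hypothesis.

## References
* T. Oba, *Stein fillings of homology 3-spheres and mapping class groups*, Geom. Dedicata 183
  (2016); arXiv:1407.5257: Thm. 1.1 and its proof (§3.2, p. 8), Thm. 1.3, §2.2 (p. 5), Props. 3.5,
  3.6 (p. 7). [Oba2016]
* C. Wendl, *Strongly fillable contact manifolds and `J`-holomorphic foliations*, Duke Math. J. 151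
  (2010); arXiv:0806.3193, Thm. 1 (p. 4), proof of Cor. 1 (p. 5). [Wendl2010]
* A. Kas, *On the handlebody decomposition associated to a Lefschetz fibration*, Pacific J. Math.
  89 (1980), 89–104. [Kas1980]
* R. E. Gompf, A. I. Stipsicz, *4-Manifolds and Kirby Calculus*, GSM 20 (1999), §8.2.
  [GompfStipsiczGSM1999]
* J. Milnor, *Lectures on the h-cobordism theorem* (1965), Thm. 8.1 Index 0; *Morse theory* (1963),
  Thm. 3.1. [MilnorHCobordism1965] [Milnor1963]
-/

noncomputable section

open Set Function
open scoped Manifold ContDiff Topology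

namespace Literature.Geometry.Symplectic

open Literature.Topology.FourManifolds

universe u

/-! ### §1 Binding components of an open book -/

section Binding

variable {M : Type u} [TopologicalSpace M] [ChartedSpace (EuclideanSpace ℝ (Fin 3)) M]
  [IsManifold (𝓡 3) ∞ M]

/-- The unit circle of `ℝ²` is connected. [folklore] -/
private theorem connectedSpace_circle :
    ConnectedSpace (Metric.sphere (0 : EuclideanSpace ℝ (Fin 2)) 1) := by
  have h : 1 < Module.rank ℝ (EuclideanSpace ℝ (Fin 2)) := by
    rw [← Module.finrank_eq_rank, finrank_euclideanSpace, Fintype.card_fin]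
    norm_num
  exact Subtype.connectedSpace (isConnected_sphere h 0 zero_le_one)

/-- **Two points of one core lie in the same component of the binding** (the core is a continuous
image of the circle inside the binding). [folklore] -/
theorem OpenBook.connectedComponentsMk_core_eq (ob : OpenBook M) (i : Fin ob.k)
    (x y : Metric.sphere (0 : EuclideanSpace ℝ (Fin 2)) 1) :
    (ConnectedComponents.mk ⟨ob.core i x, ob.core_mem_binding i x⟩ :
        ConnectedComponents ob.binding) =
      ConnectedComponents.mk ⟨ob.core i y, ob.core_mem_binding i y⟩ := by
  haveI := connectedSpace_circle
  -- the core as a map into the binding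
  let c : Metric.sphere (0 : EuclideanSpace ℝ (Fin 2)) 1 → ob.binding :=
    fun z => ⟨ob.core i z, ob.core_mem_binding i z⟩
  have hc : Continuous c := (ob.continuous_core i).subtype_mk _
  have hconn : IsPreconnected (range c) := (isConnected_range hc).isPreconnected
  rw [ConnectedComponents.coe_eq_coe']
  exact hconn.subset_connectedComponent (mem_range_self y) (mem_range_self x)

/-- **The binding has at most `k` connected components**, `k` the number of binding tubes: every
point of the binding lies on some core, and each core lies in one component. [folklore] -/
theorem OpenBook.surjective_connectedComponentsMk_core (ob : OpenBook M)
    (x₀ : Metric.sphere (0 : EuclideanSpace ℝ (Fin 2)) 1) :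
    Surjective fun i : Fin ob.k =>
      (ConnectedComponents.mk ⟨ob.core i x₀, ob.core_mem_binding i x₀⟩ :
        ConnectedComponents ob.binding) := by
  intro q
  obtain ⟨⟨y, hy⟩, rfl⟩ := ConnectedComponents.surjective_coe q
  obtain ⟨i, x, hx⟩ := (ob.mem_binding_iff y).1 hy
  refine ⟨i, ?_⟩
  have hx' : (⟨ob.core i x, ob.core_mem_binding i x⟩ : ob.binding) = ⟨y, hy⟩ := Subtype.ext hx
  rw [← hx']
  exact ob.connectedComponentsMk_core_eq i x₀ x

/-- The binding has finitely many connected components. [folklore] -/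
theorem OpenBook.finite_connectedComponents_binding (ob : OpenBook M) :
    Finite (ConnectedComponents ob.binding) :=
  Finite.of_surjective _
    (ob.surjective_connectedComponentsMk_core ⟨EuclideanSpace.single 0 1, by simp⟩)

/-- **The binding of an open book with `k` tubes has at most `k` connected components.**
[folklore] -/
theorem OpenBook.natCard_connectedComponents_binding_le_k (ob : OpenBook M) :
    Nat.card (ConnectedComponents ob.binding) ≤ ob.k := by
  have h := Nat.card_le_card_of_surjective _
    (ob.surjective_connectedComponentsMk_core ⟨EuclideanSpace.single 0 1, by simp⟩)
  simpa using h

/-- The binding of an open book has at least one connected component (it is nonempty).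
[folklore] -/
theorem OpenBook.natCard_connectedComponents_binding_pos (ob : OpenBook M) :
    0 < Nat.card (ConnectedComponents ob.binding) := by
  haveI := ob.finite_connectedComponents_binding
  obtain ⟨y, hy⟩ := ob.binding_nonempty
  haveI : Nonempty (ConnectedComponents ob.binding) := ⟨ConnectedComponents.mk ⟨y, hy⟩⟩
  exact Finite.card_pos

end Binding

/-- **Homeomorphic spaces have equally many connected components.** [folklore] -/
theorem natCard_connectedComponents_congr {X Y : Type*} [TopologicalSpace X] [TopologicalSpace Y]
    (e : X ≃ₜ Y) : Nat.card (ConnectedComponents X) = Nat.card (ConnectedComponents Y) := by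
  have hfib : ∀ y, IsConnected (e ⁻¹' {y}) := fun y => by
    have : e ⁻¹' {y} = {e.symm y} := by
      ext x
      simp only [mem_preimage, mem_singleton_iff]
      exact ⟨fun h => by rw [← h, Homeomorph.symm_apply_apply], fun h => by rw [h, e.apply_symm_apply]⟩
    rw [this]
    exact isConnected_singleton
  exact Nat.card_congr (e.isQuotientMap.isCoinducing.connectedComponentsHomeomorph hfib).toEquiv

/-! ### §2 Wendl's PALF and Kas' count: the handle decomposition `(1, n, n, 0, 0)` with `n + 1 ≤ k` -/

section WendlKas

/-- **The handle count of a contractible planar Stein filling, from Wendl's PALF and Kas' count.**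
Assume (`hW`) Wendl 2010, Thm. 1 for compact Stein domains over `PALF`, and (`hK`) Kas' handle
count for planar PALFs (see the module docstring for both, quoted from Oba 2016, Thm. 1.3 and
§2.2).  Let `(W, S)` be a compact contractible Stein domain, `b` a boundary datum and `ob` a planar
open book of `b.carrier ≅ ∂W` with `ob.k` binding tubes supporting `ξ_J = boundaryPlaneField S.J b`.
Then for some `n` with `n + 1 ≤ ob.k`, `W` has a handle decomposition with one `0`-handle, `n`
`1`-handles, `n` `2`-handles and no others.  Proof: Wendl's PALF `P` has planar boundary pages and
binding homeomorphic to that of `ob`, which has at most `ob.k` components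
(`OpenBook.natCard_connectedComponents_binding_le_k`), say `n + 1`; Kas gives the count
`(1, n, #crit, 0, 0)`; and `#crit = n` since `χ(W) = 1` (Oba's Props. 3.5–3.6,
`Oba2016_prop35_of_contractible`) — *"`X` admits a PALF `f : X → D²` with fiber `Σ_{0,4}`"* and
*"the number of singular fibers of `f` is `n`"*.
[cite: Oba2016, Thm. 1.1 (proof, §3.2, p. 8), Thm. 1.3, §2.2, Props. 3.5–3.6]
[cite: Wendl2010, Thm. 1] -/
theorem Oba2016_handleCount_of_wendl_of_kas
    (hW : ∀ (W : Type) [TopologicalSpace W] [T2Space W] [SecondCountableTopology W]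
      [ChartedSpace (EuclideanHalfSpace 4) W] [IsManifold (𝓡∂ 4) ∞ W] [CompactSpace W]
      [ConnectedSpace W] (S : SteinStructure W) (b : BoundaryData (𝓡∂ 4) W (𝓡 3))
      (K : OpenBook b.carrier), K.IsPlanar → K.Supports (boundaryPlaneField S.J b) →
      ∃ P : PALF S.complexOrientation b, P.ob.IsPlanar ∧ Nonempty (P.ob.binding ≃ₜ K.binding))
    (hK : ∀ (W : Type) [TopologicalSpace W] [T2Space W] [SecondCountableTopology W]
      [ChartedSpace (EuclideanHalfSpace 4) W] [IsManifold (𝓡∂ 4) ∞ W] [CompactSpace W]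
      [ConnectedSpace W] (o : SmoothOrientation (𝓡∂ 4) W) (b : BoundaryData (𝓡∂ 4) W (𝓡 3))
      (P : PALF o b) (n : ℕ), P.ob.IsPlanar →
      Nat.card (ConnectedComponents P.ob.binding) = n + 1 →
      HasHandleDecomposition 3 W
        (fun k => if k = 0 then 1 else if k = 1 then n else if k = 2 then P.crit.card else 0))
    {W : Type} [TopologicalSpace W] [T2Space W] [SecondCountableTopology W]
    [ChartedSpace (EuclideanHalfSpace 4) W] [IsManifold (𝓡∂ 4) ∞ W] [CompactSpace W]
    [ContractibleSpace W] (S : SteinStructure W) (b : BoundaryData (𝓡∂ 4) W (𝓡 3))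
    (ob : OpenBook b.carrier) (hpl : ob.IsPlanar) (hsup : ob.Supports (boundaryPlaneField S.J b)) :
    ∃ n : ℕ, n + 1 ≤ ob.k ∧
      HasHandleDecomposition 3 W
        (fun k => if k = 0 then 1 else if k = 1 then n else if k = 2 then n else 0) := by
  -- Wendl: a planar PALF on `W` with binding homeomorphic to that of `ob`
  obtain ⟨P, hPpl, ⟨e⟩⟩ := hW W S b ob hpl hsup
  -- the number of binding components, `n + 1 ≤ ob.k`
  have hle : Nat.card (ConnectedComponents P.ob.binding) ≤ ob.k := by
    rw [natCard_connectedComponents_congr e]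
    exact ob.natCard_connectedComponents_binding_le_k
  have hpos : 0 < Nat.card (ConnectedComponents P.ob.binding) :=
    P.ob.natCard_connectedComponents_binding_pos
  obtain ⟨n, hn⟩ : ∃ n, Nat.card (ConnectedComponents P.ob.binding) = n + 1 :=
    ⟨Nat.card (ConnectedComponents P.ob.binding) - 1, by omega⟩
  -- Kas: the count `(1, n, #crit, 0, 0)`
  have hd := hK W S.complexOrientation b P n hPpl hn
  -- `χ(W) = 1`: `#crit = n`
  have h12 := Oba2016_prop35_of_contractible W hd (by simp) (by simp) (by simp)
  simp only [if_true, if_false, show (2 : ℕ) ≠ 0 from by norm_num,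
    show (2 : ℕ) ≠ 1 from by norm_num, show (1 : ℕ) ≠ 0 from by norm_num] at h12
  refine ⟨n, by omega, ?_⟩
  convert hd using 2 with k
  rcases Nat.lt_or_ge k 3 with hk | hk
  · interval_cases k <;> simp [h12]
  · simp [show k ≠ 0 by omega, show k ≠ 1 by omega, show k ≠ 2 by omega]

end WendlKas

/-! ### §3 At most one `1`-handle: `D⁴` or the handle count `(1, 1, 1, 0, …)` (pointwise) -/

/-- **Pointwise form of `Oba2016_steinFilling_fourHoledSphere_of_oneHandle_le_one`.**  A compact
contractible `4`-manifold with boundary which has SOME handle decomposition with at most one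
`1`-handle and no handle of index `≥ 3` is diffeomorphic to `D⁴` or has a handle decomposition with
exactly one handle of each index `0, 1, 2` and none of higher index: normalise to a single
`0`-handle keeping the handles of index `≥ 2` (Milnor 1965, Thm. 8.1 Index 0,
`exists_isMorseAdapted_ncard_zero_eq_one_ncard_one_add_keep`), count `χ(W) = 1 = 1 - c₁ + c₂`
(`Oba2016_prop35_of_contractible`), so `c₂ = c₁ ∈ {0, 1}`; `c₁ = 0` is a single `0`-handle, a
`4`-disc (Milnor 1963, Thm. 3.1, `HasHandleDecomposition.nonempty_diffeomorph_closedBall_of_handleCount_one_zero`),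
`c₁ = 1` is the count `(1, 1, 1, 0, …)`. [cite: Oba2016, Thm. 1.1 (proof, §3.2) and Prop. 3.5]
[cite: MilnorHCobordism1965, Thm. 8.1 Index 0] [cite: Milnor1963, Thm. 3.1] -/
theorem Oba2016_disjunction_of_oneHandle_le_one {W : Type} [TopologicalSpace W] [T2Space W]
    [SecondCountableTopology W] [ChartedSpace (EuclideanHalfSpace 4) W] [IsManifold (𝓡∂ 4) ∞ W]
    [CompactSpace W] [ContractibleSpace W]
    (h : ∃ c : ℕ → ℕ, HasHandleDecomposition 3 W c ∧ c 1 ≤ 1 ∧ ∀ k, 3 ≤ k → c k = 0) :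
    Nonempty (W ≃ₘ⟮𝓡∂ 4, 𝓡∂ 4⟯ Metric.closedBall (0 : EuclideanSpace ℝ (Fin 4)) 1) ∨
      HasHandleDecomposition 3 W (fun k => if k ≤ 2 then 1 else 0) := by
  obtain ⟨c, ⟨f₀, hf₀, hcount⟩, hc1, hc3⟩ := h
  have hf₀' : IsMorseAdapted (𝓡∂ 4) f₀ := hf₀
  have hcount' : ∀ k, (criticalSetOfIndex (𝓡∂ 4) f₀ k).ncard = c k := hcount
  -- normalise to a single `0`-handle, keeping the handles of index `≥ 2`
  obtain ⟨r, hr⟩ : ∃ r, (criticalSetOfIndex (𝓡∂ 4) f₀ 0).ncard = r + 1 :=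
    ⟨(criticalSetOfIndex (𝓡∂ 4) f₀ 0).ncard - 1, by
      have := hf₀'.one_le_ncard_criticalSetOfIndex_zero; omega⟩
  obtain ⟨f, hf, hf0, hf1, hfk⟩ :=
    exists_isMorseAdapted_ncard_zero_eq_one_ncard_one_add_keep (n := 3) r f₀ hf₀' hr
  have hf' : IsMorseAdapted (𝓡∂ 4) f := hf
  have hf0' : (criticalSetOfIndex (𝓡∂ 4) f 0).ncard = 1 := hf0
  have hf1' : (criticalSetOfIndex (𝓡∂ 4) f 1).ncard + r = (criticalSetOfIndex (𝓡∂ 4) f₀ 1).ncard :=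
    hf1
  have hfk' : ∀ k, 2 ≤ k →
      (criticalSetOfIndex (𝓡∂ 4) f k).ncard = (criticalSetOfIndex (𝓡∂ 4) f₀ k).ncard := hfk
  have hd : HasHandleDecomposition 3 W fun k => (criticalSetOfIndex (𝓡∂ 4) f k).ncard :=
    ⟨f, hf', fun k => rfl⟩
  have hd3 : ∀ k, 3 ≤ k → (criticalSetOfIndex (𝓡∂ 4) f k).ncard = 0 := fun k hk => by
    rw [hfk' k (by omega), hcount' k]
    exact hc3 k hk
  have hd1 : (criticalSetOfIndex (𝓡∂ 4) f 1).ncard ≤ 1 := by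
    have := hcount' 1
    omega
  have h12 : (criticalSetOfIndex (𝓡∂ 4) f 1).ncard = (criticalSetOfIndex (𝓡∂ 4) f 2).ncard :=
    Oba2016_prop35_of_contractible W hd hf0' (hd3 3 le_rfl) (hd3 4 (by norm_num))
  rcases Nat.lt_or_ge (criticalSetOfIndex (𝓡∂ 4) f 1).ncard 1 with h0 | h1
  · -- no `1`-handle: a single `0`-handle, `W ≅ D⁴`
    left
    have hW : HasHandleDecomposition 3 W (handleCount 1 0) := by
      refine ⟨f, hf', fun k => ?_⟩
      show (criticalSetOfIndex (𝓡∂ 4) f k).ncard = handleCount 1 0 k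
      rcases Nat.lt_or_ge k 3 with hk | hk
      · interval_cases k
        · rw [handleCount_zero]; exact hf0'
        · rw [handleCount_one]; omega
        · rw [handleCount_of_two_le 1 0 le_rfl]; omega
      · rw [handleCount_of_two_le 1 0 (by omega)]; exact hd3 k hk
    exact hW.nonempty_diffeomorph_closedBall_of_handleCount_one_zero (by norm_num)
  · -- one `1`-handle: the handle count `(1, 1, 1, 0, …)`
    right
    refine ⟨f, hf', fun k => ?_⟩
    show (criticalSetOfIndex (𝓡∂ 4) f k).ncard = if k ≤ 2 then 1 else 0
    rcases Nat.lt_or_ge k 3 with hk | hk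
    · rw [if_pos (by omega)]
      interval_cases k
      · exact hf0'
      · omega
      · omega
    · rw [if_neg (by omega)]
      exact hd3 k hk

/-! ### §4 At most two binding tubes: the conclusion from Wendl and Kas alone -/

/-- **Oba's theorem for planar supporting open books with at most two binding tubes, from Wendl's
PALF and Kas' count.**  Assume `hW` and `hK` (module docstring).  If `(W, S)` is a compact
contractible Stein domain whose boundary complex tangencies are supported by a planar open book
with at most two binding tubes (pages a disc or an annulus), then `W` is diffeomorphic to `D⁴` or
has a handle decomposition with one handle of each index `0, 1, 2`: the count
`(1, n, n, 0, 0)` of `Oba2016_handleCount_of_wendl_of_kas` has `n + 1 ≤ 2`, so at most one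
`1`-handle, and `Oba2016_disjunction_of_oneHandle_le_one` applies — no cancellation is needed
(in Oba's proof: a PALF with fibre `D²` or `Σ_{0,2}`). [cite: Oba2016, Thm. 1.1 (proof, §3.2),
Thm. 1.3, §2.2, Props. 3.5–3.6] [cite: Wendl2010, Thm. 1] -/
theorem Oba2016_steinFilling_twoTubes_of_wendl_of_kas
    (hW : ∀ (W : Type) [TopologicalSpace W] [T2Space W] [SecondCountableTopology W]
      [ChartedSpace (EuclideanHalfSpace 4) W] [IsManifold (𝓡∂ 4) ∞ W] [CompactSpace W]
      [ConnectedSpace W] (S : SteinStructure W) (b : BoundaryData (𝓡∂ 4) W (𝓡 3))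
      (K : OpenBook b.carrier), K.IsPlanar → K.Supports (boundaryPlaneField S.J b) →
      ∃ P : PALF S.complexOrientation b, P.ob.IsPlanar ∧ Nonempty (P.ob.binding ≃ₜ K.binding))
    (hK : ∀ (W : Type) [TopologicalSpace W] [T2Space W] [SecondCountableTopology W]
      [ChartedSpace (EuclideanHalfSpace 4) W] [IsManifold (𝓡∂ 4) ∞ W] [CompactSpace W]
      [ConnectedSpace W] (o : SmoothOrientation (𝓡∂ 4) W) (b : BoundaryData (𝓡∂ 4) W (𝓡 3))
      (P : PALF o b) (n : ℕ), P.ob.IsPlanar →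
      Nat.card (ConnectedComponents P.ob.binding) = n + 1 →
      HasHandleDecomposition 3 W
        (fun k => if k = 0 then 1 else if k = 1 then n else if k = 2 then P.crit.card else 0))
    (W : Type) [TopologicalSpace W] [T2Space W] [SecondCountableTopology W]
    [ChartedSpace (EuclideanHalfSpace 4) W] [IsManifold (𝓡∂ 4) ∞ W] [CompactSpace W]
    [ContractibleSpace W] (S : SteinStructure W) (b : BoundaryData (𝓡∂ 4) W (𝓡 3))
    (ob : OpenBook b.carrier) (hpl : ob.IsPlanar) (hk : ob.k ≤ 2)
    (hsup : ob.Supports (boundaryPlaneField S.J b)) :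
    Nonempty (W ≃ₘ⟮𝓡∂ 4, 𝓡∂ 4⟯ Metric.closedBall (0 : EuclideanSpace ℝ (Fin 4)) 1) ∨
      HasHandleDecomposition 3 W (fun k => if k ≤ 2 then 1 else 0) := by
  obtain ⟨n, hn, hd⟩ := Oba2016_handleCount_of_wendl_of_kas hW hK S b ob hpl hsup
  refine Oba2016_disjunction_of_oneHandle_le_one ⟨_, hd, ?_, fun k hk => ?_⟩
  · show (if (1 : ℕ) = 0 then 1 else if (1 : ℕ) = 1 then n else if (1 : ℕ) = 2 then n else 0) ≤ 1
    simp only [one_ne_zero, if_false, if_true]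
    omega
  · show (if k = 0 then 1 else if k = 1 then n else if k = 2 then n else 0) = 0
    simp [show k ≠ 0 by omega, show k ≠ 1 by omega, show k ≠ 2 by omega]

/-! ### §5 The fact from Wendl, Kas and the cancellation endgame for `Σ_{0,3}`, `Σ_{0,4}` -/

/-- **`Oba2016_steinFilling_fourHoledSphere` from Wendl's PALF, Kas' count and the two
cancellations.**  Assume `hW`, `hK` (module docstring) and the residual claim `hC`: *every compact
contractible Stein domain `(W, S)` carrying a PALF `P : PALF S.complexOrientation b` with planar
boundary pages, `n + 1` binding components for `n = 2` or `n = 3`, and the Kas handle count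
`(1, n, n, 0, 0)`, has a handle decomposition with at most one `1`-handle and no handle of index
`≥ 3`* — Oba 2016, §3.2: with `H₁(W; ℤ) = 0` at least one vanishing cycle is a boundary curve
(*"If these curves are of non-boundary, then `H₁(X; ℤ)` has a torsion element"*), boundary twists
are central, and in each of the three cases two `1`-handle/`2`-handle pairs of the Kirby diagram
cancel (Fig. 2: *"we can find two cancelling pairs"*); for `n = 2` every vanishing cycle of the pair
of pants is a boundary curve.  Then the fact holds: pad/read the supporting open book (`ob.k = 4`
tubes, so `n + 1 ≤ 4` components, `Oba2016_handleCount_of_wendl_of_kas`); for `n ≤ 1` conclude by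
`Oba2016_disjunction_of_oneHandle_le_one` directly, for `n ∈ {2, 3}` through `hC`.
[cite: Oba2016, Thm. 1.1 (proof, §3.2, p. 8, cases (1)–(3) and Fig. 2)] [cite: Wendl2010, Thm. 1] -/
theorem Oba2016_steinFilling_fourHoledSphere_of_wendl_of_kas_of_cancel
    (hW : ∀ (W : Type) [TopologicalSpace W] [T2Space W] [SecondCountableTopology W]
      [ChartedSpace (EuclideanHalfSpace 4) W] [IsManifold (𝓡∂ 4) ∞ W] [CompactSpace W]
      [ConnectedSpace W] (S : SteinStructure W) (b : BoundaryData (𝓡∂ 4) W (𝓡 3))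
      (K : OpenBook b.carrier), K.IsPlanar → K.Supports (boundaryPlaneField S.J b) →
      ∃ P : PALF S.complexOrientation b, P.ob.IsPlanar ∧ Nonempty (P.ob.binding ≃ₜ K.binding))
    (hK : ∀ (W : Type) [TopologicalSpace W] [T2Space W] [SecondCountableTopology W]
      [ChartedSpace (EuclideanHalfSpace 4) W] [IsManifold (𝓡∂ 4) ∞ W] [CompactSpace W]
      [ConnectedSpace W] (o : SmoothOrientation (𝓡∂ 4) W) (b : BoundaryData (𝓡∂ 4) W (𝓡 3))
      (P : PALF o b) (n : ℕ), P.ob.IsPlanar →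
      Nat.card (ConnectedComponents P.ob.binding) = n + 1 →
      HasHandleDecomposition 3 W
        (fun k => if k = 0 then 1 else if k = 1 then n else if k = 2 then P.crit.card else 0))
    (hC : ∀ (W : Type) [TopologicalSpace W] [T2Space W] [SecondCountableTopology W]
      [ChartedSpace (EuclideanHalfSpace 4) W] [IsManifold (𝓡∂ 4) ∞ W] [CompactSpace W]
      [ContractibleSpace W] (S : SteinStructure W) (b : BoundaryData (𝓡∂ 4) W (𝓡 3))
      (P : PALF S.complexOrientation b) (n : ℕ), P.ob.IsPlanar →
      Nat.card (ConnectedComponents P.ob.binding) = n + 1 → 2 ≤ n → n ≤ 3 →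
      HasHandleDecomposition 3 W
        (fun k => if k = 0 then 1 else if k = 1 then n else if k = 2 then n else 0) →
      ∃ c : ℕ → ℕ, HasHandleDecomposition 3 W c ∧ c 1 ≤ 1 ∧ ∀ k, 3 ≤ k → c k = 0) :
    Oba2016_steinFilling_fourHoledSphere := by
  intro W _ _ _ _ _ _ _ S hS
  obtain ⟨b, ob, hpl, hk, hsup⟩ := hS
  -- Wendl: a planar PALF on `W` with binding homeomorphic to that of `ob`
  obtain ⟨P, hPpl, ⟨e⟩⟩ := hW W S b ob hpl hsup
  have hle : Nat.card (ConnectedComponents P.ob.binding) ≤ 4 := by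
    rw [natCard_connectedComponents_congr e]
    have := ob.natCard_connectedComponents_binding_le_k
    omega
  have hpos : 0 < Nat.card (ConnectedComponents P.ob.binding) :=
    P.ob.natCard_connectedComponents_binding_pos
  obtain ⟨n, hn⟩ : ∃ n, Nat.card (ConnectedComponents P.ob.binding) = n + 1 :=
    ⟨Nat.card (ConnectedComponents P.ob.binding) - 1, by omega⟩
  -- Kas: `(1, n, #crit, 0, 0)`, and `#crit = n` by `χ(W) = 1`
  have hd := hK W S.complexOrientation b P n hPpl hn
  have h12 := Oba2016_prop35_of_contractible W hd (by simp) (by simp) (by simp)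
  simp only [if_true, if_false, show (2 : ℕ) ≠ 0 from by norm_num,
    show (2 : ℕ) ≠ 1 from by norm_num, show (1 : ℕ) ≠ 0 from by norm_num] at h12
  have hd' : HasHandleDecomposition 3 W
      (fun k => if k = 0 then 1 else if k = 1 then n else if k = 2 then n else 0) := by
    convert hd using 2 with k
    rcases Nat.lt_or_ge k 3 with hk' | hk'
    · interval_cases k <;> simp [h12]
    · simp [show k ≠ 0 by omega, show k ≠ 1 by omega, show k ≠ 2 by omega]
  refine Oba2016_disjunction_of_oneHandle_le_one ?_
  rcases Nat.lt_or_ge n 2 with hn2 | hn2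
  · -- fibre a disc or an annulus: at most one `1`-handle already
    refine ⟨_, hd', ?_, fun k hk3 => ?_⟩
    · show (if (1 : ℕ) = 0 then 1 else if (1 : ℕ) = 1 then n else if (1 : ℕ) = 2 then n else 0) ≤ 1
      simp only [one_ne_zero, if_false, if_true]
      omega
    · show (if k = 0 then 1 else if k = 1 then n else if k = 2 then n else 0) = 0
      simp [show k ≠ 0 by omega, show k ≠ 1 by omega, show k ≠ 2 by omega]
  · -- fibre `Σ_{0,3}` or `Σ_{0,4}`: the two cancellations
    exact hC W S b P n hPpl hn hn2 (by omega) hd'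

/-! ### §6 Status — what a discharge of the fact still needs, and the Morse-theoretic endgame

`Oba2016_steinFilling_fourHoledSphere` is closed modulo the three hypotheses of §5 (and outright for
`ob.k ≤ 2` modulo `hW`, `hK`, §4).  For planners and librarians — the proving lineage of a fact may
not file named facts (D-0026, `lint.fact-fanout`), so the record is kept here:

* **`hW`, `hK` are verbatim the bodies of the two named facts a consumer would cite**, intended as
  `Literature.Geometry.Symplectic.Wendl2010_planarStein_palf` — [cite: Wendl2010, Thm. 1 (arXiv
  p. 4) with the proof of Cor. 1 (p. 5); Oba2016, Thm. 1.3] — in its own file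
  `PlanarSteinLefschetzFibration.lean` importing `SteinPALF` only, and
  `Literature.Geometry.Symplectic.Kas1980_planarPALF_handleCount` — [cite: Kas1980;
  GompfStipsiczGSM1999, §8.2; Oba2016, §2.2 (p. 5) and proof of Prop. 3.6 (p. 7)] — in its own
  file `PlanarPALFHandleCount.lean` importing `SteinPALF` and `Handles`.  Neither is within the
  tree's proved depth (Wendl: compactness and intersection theory of `J`-holomorphic foliations —
  XL; Kas: Ehresmann's theorem for the bordered fibration, `Σ_{0,n+1} × D² = h⁰ ∪ n h¹`, one
  `2`-handle per node — L/XL).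
* **`hC` is an argument, not a published statement** (Oba 2016, §3.2: *"We can find two cancelling
  `1`-handle/`2`-handle pairs in the diagram"*).  Its handle-count hypothesis is a convenience only:
  a proof must re-derive from `P` Kas' decomposition WITH INCIDENCES and then cancel.  In the tree's
  Morse vocabulary the inputs are: (iv) **Kas with incidences** — from `P : PALF o b` with planar
  pages and a system `u₁, …, u_n` of disjoint proper arcs cutting the page into a disc: a Morse
  function on `Cobordism.ofBoundary W` with a smooth gradient-like field `ξ`, critical points
  `m` / `p₁ … p_n` / `q₁ … q_{#crit}` of index `0` / `1` / `2` on three levels, and in a level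
  between the last two `S_R(pᵢ) ∩ S_L(q_j)` = the (transverse) crossings of the vanishing cycle
  `c_j` with `uᵢ`, each an `IsTransverseInLevel` point [Kas1980; GompfStipsiczGSM1999, §8.2];
  (v) **the `H₁` reader** `H₁(W; ℤ) ≅ ℤⁿ ⧸ ⟨algebraic incidence rows⟩` (cellular homology of the
  decomposition), so that contractibility makes the hole-incidence matrix of the `c_j` unimodular —
  the page side of this is PROVED over the word calculus (`PlanarLefschetzBodyWinding.lean` §§1–5,
  the parity lemma of `PlanarHomologySphereFillingsDictionary.lean`); (vi) **page topology** over
  `PlaneTopology` (Jordan, Schoenflies, annulus theorem, all proved): a cycle whose row is a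
  boundary row is boundary-parallel; isotoping a cycle within its page does not change `W`; arcs
  crossing a given cycle once.  Generic Morse lemmas: (i) critical points on one level have
  disjoint `trajectorySet`s — PROVED, `IsGradientLike.disjoint_trajectorySet_of_apply_eq`, with
  the inversion input `IsGradientLike.disjoint_trajectorySet_of_disjoint_spheres`
  (`HandleSpheres.lean`); (ii) the number of `ξ`-trajectories from `p` to `q` is
  `#(S_R(p, c) ∩ S_L(q, c))` for every level `c` between them of EVERY Morse function having `ξ`
  as a gradient-like field, and (iii) transport of `IsTransverseInLevel` between such levels
  along the flow — to be ASSEMBLED from `Cobordism.SlabFlow.levelDiffeomorph`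
  (`LevelTranslation.lean`), `leftHandSphere_eq_of_field_eq_of_le`
  (`HCobordismSecondCancellation.lean`), `mem_unstableSet_of_field_eq_of_apply_le`
  (`HCobordismAuxiliaryPair.lean`), `leftHandSphere_eq_image_of_flowsTo` and
  `exists_flowsTo_of_mem_unstableSet`.  PROVED and ready:
  `Cobordism.Milnor1965_rearrangement_slab_holds` (4.1/4.2),
  `Cobordism.Milnor1965_firstCancellation_slab_holds` (5.4),
  `Cobordism.Milnor1965_exists_isGradientLike_disjoint_spheres_slab_holds` (4.4), the conversions
  `IsMorseAdapted ↔ Cobordism.IsMorseFunction` of `SPC4HandlesCancelStep.lean`, and the final step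
  `Oba2016_steinFilling_fourHoledSphere_of_isMorseAdapted_ncard_one_le_one` (`…Proofs.lean`).
  **UPDATE (same day): the Morse-theoretic half is now PROVED** — (ii) is
  `ConnectingTrajectoryLevels.lean` (`exists_handSpheres_inter_eq_singleton_of_eq_singleton`:
  meeting points are level- and function-independent for a fixed field), the double cancellation
  is `DoubleCancellationSlabs.lean` (`Cobordism.exists_firstCancellation_two_slabs`, read on
  `(W; ∅, ∂W)` as `exists_isMorseAdapted_ncard_one_sub_two_of_two_slabs`), and
  `PlanarHomologySphereFillingsCancel.lean` derives `hC` and the fact from `hW`, `hK` and the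
  INPUT of the cancellations only (`hI`: Kas' incidences in two-slab form,
  `Oba2016_steinFilling_fourHoledSphere_of_wendl_of_kas_of_kasIncidence`).  What is left for `hI`
  is (iv)–(vi); stating (iv) with a PRESCRIBED admissible order of the critical values (each
  `2`-handle above the `1`-handles its cycle crosses, Gompf–Stipsicz §4.2) puts the two pairs in
  disjoint slabs from the start and makes (iii) and all rearrangements unnecessary.
* **The cancellation then needs no handle slides** (unlike the Kirby-diagram proof, Oba Fig. 2).
  By (v) some cycle `α` has a boundary row (three non-boundary rows of `Σ_{0,4}` have even
  determinant; in `Σ_{0,3}` every allowable cycle is boundary-parallel), so `α ∥ ∂_a` by (vi); let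
  `β` be any other cycle (its row differs from `α`'s by unimodularity, so both sides of `β` contain
  a boundary component other than `∂_a`).  Isotope `β` off the collar of `∂_a` bounded by `α`
  (`i(α, β) = 0`); take `u₁` from `∂_a` across `α` (one crossing) to another component, `u₂` off
  that collar joining two components `≠ a` on opposite sides of `β` and crossing `β` once, and
  complete to a cutting system.  Cycles other than `α` may cross `u₁`, and cycles other than
  `α, β` may cross `u₂`: immaterial.  What matters is `α ∩ u₂ = ∅`: no trajectory runs from `p₂`
  to `q_α`, so with (i) Thms. 4.1/4.2 arrange the levels as
  `p_rest < p₁ < q_α < p₂ < q_β < q_rest`, putting `{p₁, q_α}` and `{p₂, q_β}` alone in two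
  DISJOINT slabs, each pair meeting in one transverse point by (ii)–(iv).  Thm. 5.4 in the first
  slab changes function and field only on that slab, so the second slab keeps its critical points,
  levels and hand spheres, and 5.4 applies again; what is left has `n - 2 ≤ 1` critical points of
  index `1` and none of index `≥ 3`, and
  `Oba2016_steinFilling_fourHoledSphere_of_isMorseAdapted_ncard_one_le_one` concludes.  (The naive
  variant "both pairs isolated from ALL other handles" is impossible in general: when `β` and a
  third cycle `γ` fill `Σ_{0,4}` with `i(β, γ) ≥ 6`, every arc crossing `β` once meets `γ`.)
* **UPDATE 2 (2026-08-17, later): where (iv)–(vi) stand against the tree, and the one piece of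
  surface topology that (iv) hides.**  (a) *The concrete planar base exists.*
  `IsHoledDiscMorseFunction.FourThickening` (`ThickenedHandlebodyFour.lean`) is
  `B_q = {q(x, y) + z² + w² ≤ c} ⊂ ℝ⁴` for a planar Morse function `q` with one minimum and `n`
  saddles below `c` and its maxima above `c` (`exists_isHoledDiscMorseFunction`,
  `PlanarMorseHandlebodies.lean`): a `RegularSublevel` carrying the Morse function
  `thicken₄ (thicken q)` with one index-`0` and `n` index-`1` critical points `(s_j, 0, 0)` and
  `hasHandleDecomposition_fourThickening` `= (1, n, 0, …)` — on paper `Σ_{0,n+1} × D²`.  Its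
  boundary carries the open book `(z, w)/‖(z, w)‖` with binding `{q = c, z = w = 0} = ∂P`,
  `P = {q ≤ c} ⊂ ℝ²` the planar page with `n` holes (around the maxima), each page `arg (z, w) = θ`
  projecting homeomorphically onto the interior `{q < c}` of `P`.  (b) *(iv) splits in three.*
  (iv-a) PROVABLE, generic: for a gradient-like field `ξ_q` of `q`, the product field
  `ξ = ξ_q ⊕ 2(z ∂_z + w ∂_w)` is gradient-like for the thickening (Milnor-standard near the
  critical points, product of the Morse charts) and its flow is a product, so
  `W^u(s_j, 0, 0) = W^u_{ξ_q}(s_j) × ℝ²`: the right-hand sphere of `p_j = (s_j, 0, 0)` in `∂B_q`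
  meets the page of angle `θ` in the ASCENDING ARC `u_j` of the saddle `s_j` (the co-core of the
  `j`-th `1`-handle), and a circle in that page lying over a Jordan curve `c ⊂ P ∖ ∂P` meets
  `S_R(p_j)` exactly over `c ∩ u_j`, transversally in the level iff `c ⋔ u_j` in `P`; about
  1 kLoC including the transfers `ℝ⁴ → RegularSublevel → Cobordism.ofBoundary`; not in the tree.
  (iv-b) CITABLE, the Morse form of Kas 1980 / Gompf–Stipsicz §8.2 read through Milnor 1965
  §3 (an elementary cobordism of index `2` is a `2`-handle with prescribed left-hand sphere):
  `W` admits `(g, ξ)` extending `(B_q, thicken₄ (thicken q), ξ)` through an embedding onto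
  `{g ≤ c}`, the other critical points being `#crit(P)` points of index `2` at prescribed distinct
  values whose left-hand spheres, flowed down to `∂B_q`, are the lifts to pages `θ_i` of Jordan
  curves `c_i ⊂ P ∖ ∂P` — the vanishing cycles drawn in the model page under SOME identification
  of the fibre with `P`, any representatives of their isotopy classes.  (iv-c) the 2D input which
  the phrase "a system `u₁, …, u_n` of disjoint proper arcs" in (iv) above conceals: the co-cores
  of `B_q` are FIXED (the ascending arcs of `q`), whereas the arcs `u₁, u₂` of the previous bullet
  are chosen adapted to `α, β`.  Matching the two is the CHANGE OF COORDINATES PRINCIPLE in the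
  planar page (Farb–Margalit 2012, §1.3; classification of planar surfaces): a diffeomorphism `ψ`
  of `P`, boundary components possibly permuted — i.e. a total conjugation of the PALF, Oba §3.2
  *"Considering the conjugate of `φ` by an appropriate mapping class if necessary, we can assume
  that `α` and `β` lie in `Σ_{0,4}` as Figure 1"* — with `ψ(α)` a small circle about one hole
  (meeting only that hole's co-core, once) and `ψ(β)` standard (meeting a second co-core once and
  not the first hole's).  For the boundary-parallel `α` the annulus theorem of `PlaneTopology`
  (`annulus_theorem`, topological, with prescribed boundary maps) is the right input; for a
  non-boundary `β ⊂ Σ_{0,4}` (two pairs of pants on either side) nothing in the tree applies, and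
  no winding-number argument can replace it: the hole set of a Jordan curve in `P₃` does NOT
  determine its isotopy class when it has two elements (curves of slopes `p/q` with the same
  parities induce the same partition of the four boundary components), so the geometric
  intersection of `β` with a fixed co-core is unbounded over the isotopy classes with a given row.
  For `n = 2` (`Σ_{0,3}`, three binding components) every allowable cycle is boundary-parallel and
  (iv-c) reduces to the annulus theorem.  This — smooth change of coordinates in `Σ_{0,4}` — is
  the irreducible missing piece besides `hW`, `hK`: L–XL of surface topology.  (c) *(v) is
  cheaper through `π₁` than through cellular homology.*  `W` contractible ⇒ the attaching classes
  normally generate `π₁(B_q)` (Kosinski VII §7); the tree PROVES this for `2`-handles on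
  `5`-manifolds (`HandleAttachingMap.IsMultiAttachment.normalClosure_eq_top_of_simplyConnectedSpace`,
  `TwoHandleAttachmentPi1.lean`, over `HandleAttachingMap 4 2`), and the port to
  `HandleAttachingMap 3 2` is mechanical (the handle piece `D⁴ ∖ S` is star-shaped, the tube
  deformations are blockwise formulas); with `π₁(B_q) ≅ π₁(P)` (`B_q` shrinks onto `P × 0` along
  `(z, w) ↦ t (z, w)`) and the winding homomorphism `π₁(P) → ℤⁿ` about the `n` maxima of `q`
  (surjective on the hole circles; `PlanarLefschetzBodyWinding.lean` §2 has it for the model page)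
  abelianisation gives `ℤⁿ = ⟨winding rows of the c_i⟩`, the unimodularity consumed by the parity
  lemma — no homology theory needed; about 1.5 kLoC, generic.  (d) *(vi)* is then only used inside
  (iv-c).  Sizes: (iv-a) ≈ 1 kLoC, (v) ≈ 1.5 kLoC, assembly over `DoubleCancellationSlabs.lean`
  ≈ 0.5 kLoC, (iv-c) L–XL; and everything stays conditional on `hW` (Wendl 2010, Thm. 1), which
  remains a named hypothesis — the fact is an honest apex over Wendl's theorem.
-/

end Literature.Geometry.Symplectic

end
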